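import Summits.BirchSwinnertonDyer.BirchSwinnertonDyer.Theorems.ThetaPartnerAtTwoSignedMainConjectureCMTwoRankZeroUnitZonePub
import HarnessLib

/-!
# Route `ThetaPartnerAtTwo` (TP2), crux K2r0 `SignedMainConjectureCMTwoRankZero` (stmt-BirchSwinnertonDyer-20312), line
# `rankzero` v13: the EXACT `+` main conjecture at `2` (conjunct 2 of the crux) does NOT depend on the analytic `μ`-stub —
# for every rank-`0` CM curve it follows from print + the TWO-SIDED «main conjecture modulo powers of `2`» alone

HONEST FRAMING (cell `pub/bsd-wall`, W-ALL row 1, lead prover `bsd-wall-tp2-p2` g6, 2026-08-28). Nothing here is the crux and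
BSD is not proved by any of this. The registered skeleton `rankzero` v13 has three GLOBAL stubs: (LD±2^k)_A (the ONE-SIDED
Eisenstein half of Kobayashi's `+` main conjecture at `2` in `Λ ⊗ ℚ₂`), (μ♭)_A (some coefficient of `L♭` is a unit) and PUB.
With the ONE-sided (LD±2^k)_A the lift to the integral statement needs (μ♭)_A (prime avoidance, p592928), so in v13 BOTH
conjuncts of the crux lean on the `μ`-stub. This file records the sharper dependency for the planner's promote-stub decision
(PR04-AT-TWO.md §5, crux dir): the natural output of the Pollack–Rubin port at `2` is the TWO-SIDED statement (MC±2^k)_A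
(`2^{m'}·ι g = 2^m·ϖ·ι L♭`; the route's v10 stub), and from it the EXACT main conjecture `KobayashiMainConjecture A 2 1`
follows for every rank-`0` CM `A` with NO `μ`-input at all — rank-`0` rigidity pins `m = m'` (p587266 §1: `ord₂ g(0) =
ord₂ (ϖ·L♭)(0)` from BSD₂(A) + Kim's control at `2`, both in hand: Burungale–Flach by name, HONDA⁺@2 landed p592468).
So the `μ`-stub (μ♭)_A bears ONLY on the clause `μ⁺ = 0` of conjunct 1 (where it is also NECESSARY: p531532).

* §1 `kobayashiMainConjecture_two_one_at_of_honda_of_upToTwoPower` — at one curve: HONDA⁺@2(A) + print (BF24, entire `L`, GZK,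
  Greenberg ×5) + (MC±2^k)_A ⇒ `KobayashiMainConjecture A 2 1`. No period-unit fact, no modular parametrisation, no `μ`.
* §2 `kobayashiMainConjecture_two_one_of_pub_of_upToTwoPowerNonUnit` — class-wide: PUB (ten facts, as in the skeleton) +
  (MC±2^k)_A asked only OFF the unit zone (`2 ∣ #Ш(A)·∏c_ℓ(A)`) ⇒ `∀ A, KobayashiMainConjecture A 2 1` (HONDA discharged by the
  landed `stub_plusHondaSystemCMTwo`; unit zone by p593505).
* §3 `signedMainConjectureCMTwoRankZero_body_of_pub_of_upToTwoPower_of_flat` — class-wide BODY of the crux (both conjuncts) from PUB +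
  the TWO-SIDED (MC±2^k)_A + (μ♭)_A, both off the unit zone: the turnkey composition for a two-sided promote (p594360's shape).

References: [PollackRubin2004] Thm. 7.3 (p > 2); [Kobayashi2003] Conjecture (p. 2), Thm. 1.2; [BDKim2013] Cor. 3.15;
[BurungaleFlach2024] Thm. 1.1; [GreenbergLNM1716] §4; [Sprung2012] Thm. 2.2.
-/

set_option autoImplicit false
-- the Theorems namespace of this sub repeats the summit name by design (D-0017 nested layout)
set_option linter.dupNamespace false

noncomputable section

open scoped Classical NumberField MatrixGroups ModularForm

open NumberField IsDedekindDomain CongruenceSubgroup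

namespace Summit.BirchSwinnertonDyer.BirchSwinnertonDyer.Theorems

open Literature.NumberTheory.EllipticCurves Literature.NumberTheory.GaloisRepresentations
  WeierstrassCurve ZpExtension Literature.NumberTheory.EllipticCurves.Kobayashi2003
  Literature.NumberTheory.EllipticCurves.IwasawaDual Literature.NumberTheory.EllipticCurves.GreenbergVatsal2000
  Literature.NumberTheory.EllipticCurves.ModularForms Literature.NumberTheory.EllipticCurves.Rank1Residual
  Literature.NumberTheory.EllipticCurves.Rank1Residual.Typed
  Summit.BirchSwinnertonDyer.Rank1Residual Summit.BirchSwinnertonDyer.Rank1Residual.Supersingular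

/-! ## §1. At one curve: HONDA⁺@2(A) + print + (MC±2^k)_A ⇒ the exact `+` main conjecture at `2`, no `μ`-input -/

/-- **The exact `+` main conjecture at `2` for a rank-`0` CM curve from the main conjecture MODULO POWERS OF `2`, with no
analytic `μ`-hypothesis.** `A/ℚ` CM, globally minimal, analytic rank `0`, good supersingular at `2`, `a₂ = 0`; grant BY NAME
Burungale–Flach (`hBF`), the entire continuation (`hLrat`), Gross–Zagier–Kolyvagin (`hGZK`) and Greenberg's five structure facts
(`hC h412 hcork hP108 hWL`); assume a plus Honda system at `2` for `A` (`hhonda`, HONDA⁺@2(A) — landed class-wide, p592468) and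
(MC±2^k)_A (`hup`): at every normalised cyclotomic datum `char X⁺ = (g)` with `2^{m'}·ι g = 2^m·ϖ·ι L♭`. Then
`KobayashiMainConjecture A 2 1`: torsion from the signed Euler characteristic (p585652 §§2–3), and `ι g = ϖ·ι L♭` EXACTLY because
`ord₂ g(0) = ord₂ (ϖ·L♭)(0)` forces `m = m'` (p587266 §1). [cite: Kobayashi2003, Conjecture (p. 2) and Thm. 1.2]
[cite: BDKim2013, Cor. 3.15 (p. 199; p odd in print)] [cite: BurungaleFlach2024, Thm. 1.1] [cite: PollackRubin2004, Thm. 7.3 (p > 2)] -/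
theorem kobayashiMainConjecture_two_one_at_of_honda_of_upToTwoPower
    (A : WeierstrassCurve ℚ) [A.IsElliptic] [A.IsGloballyMinimal]
    (hBF : bsdTriple_of_hasCM_of_L_one_ne_zero) (hLrat : hasEntireLFunction_rat)
    (hGZK : rank_eq_analyticRank_of_analyticRank_le_one)
    (hC : Greenberg1999.casselsSurjectivity_H1Sigma ℚ)
    (h412 : Greenberg1999.prop412_noFiniteSubmodule_H1Sigma_of_rank_one)
    (hcork : Greenberg1999.h1Sigma_zpCorank_le_degree ℚ)
    (hP108 : Greenberg1999.localQuotient_restriction_surjective ℚ)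
    (hWL : Greenberg1999.h1SigmaInfty_rank_eq_one)
    (hcm : A.HasCM) (hr : A.analyticRank = 0) (hss : GoodSS A 2) (ha : A.frobeniusTrace 2 = 0)
    (hhonda : ∀ (κ : ZpExtension ℚ 2), κ.IsCyclotomic →
      ∀ (v : HeightOneSpectrum (𝓞 ℚ)), (2 : 𝓞 ℚ) ∈ v.asIdeal →
      ∃ d : ℕ → localPoints A (v.adicCompletion ℚ),
        (∀ m, d m ∈ localLayerPointsOfEmb κ (closureEmb (K := ℚ) (v.adicCompletion ℚ)) A m) ∧
        (∀ m, localTraceOfEmb κ (closureEmb (K := ℚ) (v.adicCompletion ℚ)) A (m + 1) (m + 2) (d (m + 2)) = -d m) ∧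
        (∀ m : ℕ, 1 ≤ m → ∀ P ∈ localLayerPointsOfEmb κ (closureEmb (K := ℚ) (v.adicCompletion ℚ)) A m,
          ∃ B ∈ AddSubgroup.closure (Set.range fun σ : Field.absoluteGaloisGroup (v.adicCompletion ℚ) ↦ σ • d m),
            ∃ P' ∈ localLayerPointsOfEmb κ (closureEmb (K := ℚ) (v.adicCompletion ℚ)) A (m - 1),
            ∃ R ∈ localLayerPointsOfEmb κ (closureEmb (K := ℚ) (v.adicCompletion ℚ)) A m, P = B + P' + 2 • R) ∧
        (∀ P ∈ localLayerPointsOfEmb κ (closureEmb (K := ℚ) (v.adicCompletion ℚ)) A 0,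
          ∃ a : ℤ, ∃ R ∈ localLayerPointsOfEmb κ (closureEmb (K := ℚ) (v.adicCompletion ℚ)) A 0, P = a • d 0 + 2 • R))
    (hup : ∀ (κ : ZpExtension ℚ 2) (γ : Field.absoluteGaloisGroup ℚ),
      κ.IsCyclotomic → κ.IsTopGenerator γ → IsCyclotomicVariable 2 γ →
      ∀ [NeZero (A.conductorNorm ℤ)] (f : CuspForm (Gamma0 (A.conductorNorm ℤ)) 2),
        IsNewformOf A f → ∀ (ϖ : ℚ), (ϖ : ℝ) * A.realPeriodRat = plusPeriod f →
      ∀ (Lplus Lminus : IwasawaAlgebra 2), IsPollackPair f 2 Lplus Lminus →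
      ∀ (D : SignedSelmerDualData A κ γ 1),
        ∃ (g : IwasawaAlgebra 2) (m m' : ℕ), D.charIdeal = Ideal.span {g} ∧
          PowerSeries.C ((2 : ℚ_[2]) ^ m') * iwasawaToPowerSeries 2 g =
            PowerSeries.C ((2 : ℚ_[2]) ^ m * (ϖ : ℚ_[2])) * iwasawaToPowerSeries 2 (kobayashiL 1 Lplus Lminus)) :
    KobayashiMainConjecture A 2 1 := by
  have hSel : Finite (A.selmerGroupPInfty 2) := finite_selmerGroupPInfty_two_of_analyticRank_eq_zero A hGZK hr
  -- (EC2)_A from the three local statements, all read off HONDA⁺@2(A) (LEV0@2 is a theorem for every curve)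
  have hEC := fun (κ : ZpExtension ℚ 2) (γ : Field.absoluteGaloisGroup ℚ) (hκ : κ.IsCyclotomic)
      (hγ : κ.IsTopGenerator γ) (hSel' : Finite (A.selmerGroupPInfty 2)) ↦
    signedEulerCharTwo_at_of_local A hss hκ hγ (localNonDivCMTwo_at (A := A) κ hκ)
      (plusCyclicLayersCMTwo_at_of_honda hss hhonda κ hκ) (plusLocKummerCMTwo_at_of_honda hss hhonda κ hκ)
      hC h412 hcork hP108 hWL hSel'
  -- (T2)_A and (K4c)_A
  have hT2 : ∀ (κ : ZpExtension ℚ 2) (γ : Field.absoluteGaloisGroup ℚ), κ.IsCyclotomic → κ.IsTopGenerator γ →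
      ∀ D : SignedSelmerDualData A κ γ 1, Module.IsTorsion (IwasawaAlgebra 2) D.X :=
    fun κ γ hκ hγ D ↦ (finiteTorsion_at_of_signedEulerCharTwo hEC hSel κ γ hκ hγ D).2
  have hKim := kimControl_at_of_signedEulerCharTwo hEC
  -- `L(A,1) ≠ 0` and BSD₂(A) from print
  have hL : A.entireLFunction 1 ≠ 0 := (A.analyticRank_eq_zero_iff_holds (hLrat A)).mp hr
  have hBSD : BSDp A 2 :=
    forall_bsdp_of_bsdTriple A A.tamagawaProduct_pos_holds (hBF A hcm hL) 2 Nat.prime_two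
  intro κ γ hκ hγ hγ' _ f hf ϖ hϖ Lplus Lminus hPP D
  haveI := Kobayashi2003.SignedSelmerDualData.moduleFinite hγ D
  have hTors : Module.IsTorsion (IwasawaAlgebra 2) D.X := hT2 κ γ hκ hγ D
  obtain ⟨g, m, m', hchar, hupD⟩ := hup κ γ hκ hγ hγ' f hf ϖ hϖ Lplus Lminus hPP D
  exact ⟨hTors, g, hchar, kobayashiMainConjecture_two_one_conclusion_of_upToTwoPower A hGZK hss ha hL hBSD hKim hκ hγ D
    hTors hf hϖ hPP hchar hupD⟩

/-! ## §2. Class-wide: PUB + (MC±2^k)_A off the unit zone ⇒ the exact `+` main conjecture at `2` for every rank-0 CM `A` -/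

/-- **Conjunct 2 of K2r0 is `μ`-free.** For EVERY CM curve `A/ℚ` (globally minimal) of analytic rank `0`, good supersingular at
`2`, `a₂ = 0`: `KobayashiMainConjecture A 2 1`, GRANTED BY NAME the ten published inputs of the skeleton's PUB stub (Burungale–Flach,
modular parametrisation, entire `L`, GZK, the period unit at `2`, Greenberg ×5) and the TWO-SIDED (MC±2^k)_A asked only OFF the unit
zone `2 ∣ #Ш(A)·∏c_ℓ(A)` — with NO analytic `μ`-input. In the unit zone print suffices (p593505); off it §1 with the landed
HONDA⁺@2 (`stub_plusHondaSystemCMTwo`, p592468). [cite: Kobayashi2003, Conjecture (p. 2) and Thm. 1.2] [cite: BurungaleFlach2024, Thm. 1.1]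
[cite: PollackRubin2004, Thm. 7.3 (p > 2)] [cite: GreenbergLNM1716, Prop. 4.12, pp. 108, 140] -/
theorem kobayashiMainConjecture_two_one_of_pub_of_upToTwoPowerNonUnit
    (hBF : bsdTriple_of_hasCM_of_L_one_ne_zero)
    (hmod : nonempty_modularParametrizationData) (hLrat : hasEntireLFunction_rat)
    (hGZK : rank_eq_analyticRank_of_analyticRank_le_one)
    (h2 : Literature.NumberTheory.EllipticCurves.realPeriodRat_eq_unit_mul_plusPeriod_two)
    (hC : Greenberg1999.casselsSurjectivity_H1Sigma ℚ)
    (h412 : Greenberg1999.prop412_noFiniteSubmodule_H1Sigma_of_rank_one)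
    (hcork : Greenberg1999.h1Sigma_zpCorank_le_degree ℚ)
    (hP108 : Greenberg1999.localQuotient_restriction_surjective ℚ)
    (hWL : Greenberg1999.h1SigmaInfty_rank_eq_one)
    (hup : ∀ (A : WeierstrassCurve ℚ) [A.IsElliptic] [A.IsGloballyMinimal],
      A.HasCM → A.analyticRank = 0 → GoodSS A 2 → A.frobeniusTrace 2 = 0 →
      2 ∣ A.shaOrder * A.tamagawaProduct →
      ∀ (κ : ZpExtension ℚ 2) (γ : Field.absoluteGaloisGroup ℚ),
        κ.IsCyclotomic → κ.IsTopGenerator γ → IsCyclotomicVariable 2 γ →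
      ∀ [NeZero (A.conductorNorm ℤ)] (f : CuspForm (Gamma0 (A.conductorNorm ℤ)) 2),
        IsNewformOf A f → ∀ (ϖ : ℚ), (ϖ : ℝ) * A.realPeriodRat = plusPeriod f →
      ∀ (Lplus Lminus : IwasawaAlgebra 2), IsPollackPair f 2 Lplus Lminus →
      ∀ (D : SignedSelmerDualData A κ γ 1),
        ∃ (g : IwasawaAlgebra 2) (m m' : ℕ), D.charIdeal = Ideal.span {g} ∧
          PowerSeries.C ((2 : ℚ_[2]) ^ m') * iwasawaToPowerSeries 2 g =
            PowerSeries.C ((2 : ℚ_[2]) ^ m * (ϖ : ℚ_[2])) * iwasawaToPowerSeries 2 (kobayashiL 1 Lplus Lminus))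
    (A : WeierstrassCurve ℚ) [A.IsElliptic] [A.IsGloballyMinimal]
    (hcm : A.HasCM) (hr : A.analyticRank = 0) (hss : GoodSS A 2) (ha : A.frobeniusTrace 2 = 0) :
    KobayashiMainConjecture A 2 1 := by
  by_cases hz : 2 ∣ A.shaOrder * A.tamagawaProduct
  · exact kobayashiMainConjecture_two_one_at_of_honda_of_upToTwoPower A hBF hLrat hGZK hC h412 hcork hP108 hWL hcm hr hss ha
      (Summit.BirchSwinnertonDyer.BirchSwinnertonDyer.Cruxes.SignedMainConjectureCMTwoRankZero.RankZero.stub_plusHondaSystemCMTwo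
        A hcm hr hss ha)
      (hup A hcm hr hss ha hz)
  · exact (signedMainConjectureCMTwoRankZero_at_unitZone_of_pub hBF hmod hLrat hGZK h2 hC h412 hcork hP108 hWL
      A hcm hr hss ha hz).2

/-! ## §3. The crux BODY class-wide from PUB + the TWO-SIDED (MC±2^k)_A + (μ♭)_A (turnkey for a two-sided promote) -/

/-- **K2r0's body, class-wide, from PUB + the two-sided «main conjecture modulo powers of `2`» + analytic `μ = 0`, both asked only OFF
the unit zone.** Same shape as p594360's `signedMainConjectureCMTwoRankZero_body_of_pub_of_stubs` with the ONE-sided (LD±2^k)_A binder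
replaced by the TWO-sided (MC±2^k)_A (which implies it with cofactor `h = 1`): if the planner promotes the two-sided text, the PHASE T twin
K2r0P is `intro` ×10 + this theorem applied to the two promoted items. Conjunct 2 does not use `hμ` (§2); conjunct 1's «μ⁺ = 0» does.
[cite: PollackRubin2004, Thm. 7.3 (p > 2)] [cite: Kobayashi2003, Conjecture (p. 2), Thm. 1.2] [cite: BurungaleFlach2024, Thm. 1.1] -/
theorem signedMainConjectureCMTwoRankZero_body_of_pub_of_upToTwoPower_of_flat
    (hBF : bsdTriple_of_hasCM_of_L_one_ne_zero)
    (hmod : nonempty_modularParametrizationData) (hLrat : hasEntireLFunction_rat)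
    (hGZK : rank_eq_analyticRank_of_analyticRank_le_one)
    (h2 : Literature.NumberTheory.EllipticCurves.realPeriodRat_eq_unit_mul_plusPeriod_two)
    (hC : Greenberg1999.casselsSurjectivity_H1Sigma ℚ)
    (h412 : Greenberg1999.prop412_noFiniteSubmodule_H1Sigma_of_rank_one)
    (hcork : Greenberg1999.h1Sigma_zpCorank_le_degree ℚ)
    (hP108 : Greenberg1999.localQuotient_restriction_surjective ℚ)
    (hWL : Greenberg1999.h1SigmaInfty_rank_eq_one)
    (hup : ∀ (A : WeierstrassCurve ℚ) [A.IsElliptic] [A.IsGloballyMinimal],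
      A.HasCM → A.analyticRank = 0 → GoodSS A 2 → A.frobeniusTrace 2 = 0 →
      2 ∣ A.shaOrder * A.tamagawaProduct →
      ∀ (κ : ZpExtension ℚ 2) (γ : Field.absoluteGaloisGroup ℚ),
        κ.IsCyclotomic → κ.IsTopGenerator γ → IsCyclotomicVariable 2 γ →
      ∀ [NeZero (A.conductorNorm ℤ)] (f : CuspForm (Gamma0 (A.conductorNorm ℤ)) 2),
        IsNewformOf A f → ∀ (ϖ : ℚ), (ϖ : ℝ) * A.realPeriodRat = plusPeriod f →
      ∀ (Lplus Lminus : IwasawaAlgebra 2), IsPollackPair f 2 Lplus Lminus →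
      ∀ (D : SignedSelmerDualData A κ γ 1),
        ∃ (g : IwasawaAlgebra 2) (m m' : ℕ), D.charIdeal = Ideal.span {g} ∧
          PowerSeries.C ((2 : ℚ_[2]) ^ m') * iwasawaToPowerSeries 2 g =
            PowerSeries.C ((2 : ℚ_[2]) ^ m * (ϖ : ℚ_[2])) * iwasawaToPowerSeries 2 (kobayashiL 1 Lplus Lminus))
    (hμ : ∀ (A : WeierstrassCurve ℚ) [A.IsElliptic] [A.IsGloballyMinimal],
      A.HasCM → A.analyticRank = 0 → GoodSS A 2 → A.frobeniusTrace 2 = 0 →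
      2 ∣ A.shaOrder * A.tamagawaProduct →
      ∀ [NeZero (A.conductorNorm ℤ)] (f : CuspForm (Gamma0 (A.conductorNorm ℤ)) 2),
      IsNewformOf A f → ∀ (Lplus Lminus : IwasawaAlgebra 2), IsPollackPair f 2 Lplus Lminus →
        ∃ n : ℕ, IsUnit (PowerSeries.coeff n (kobayashiL 1 Lplus Lminus)))
    (A : WeierstrassCurve ℚ) [A.IsElliptic] [A.IsGloballyMinimal]
    (hcm : A.HasCM) (hr : A.analyticRank = 0) (hss : GoodSS A 2) (ha : A.frobeniusTrace 2 = 0) :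
    (∀ (κ : ZpExtension ℚ 2) (γ : Field.absoluteGaloisGroup ℚ), κ.IsCyclotomic → κ.IsTopGenerator γ →
      ∀ D : SignedSelmerDualData A κ γ 1, Module.IsTorsion (IwasawaAlgebra 2) D.X ∧ D.mu = 0) ∧
    KobayashiMainConjecture A 2 1 := by
  by_cases hz : 2 ∣ A.shaOrder * A.tamagawaProduct
  · refine signedMainConjectureCMTwoRankZero_at_of_pub_of_lowerUpToTwoPower_of_flat hBF hmod hLrat hGZK h2 hC h412 hcork hP108 hWL
      A hcm hr hss ha ?_ (hμ A hcm hr hss ha hz)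
    intro κ γ hκ hγ hγ' _ f hf ϖ hϖ Lplus Lminus hPP D
    obtain ⟨g, m, m', hchar, hupD⟩ := hup A hcm hr hss ha hz κ γ hκ hγ hγ' f hf ϖ hϖ Lplus Lminus hPP D
    exact ⟨g, 1, m, m', hchar, by rw [mul_one]; exact hupD⟩
  · exact signedMainConjectureCMTwoRankZero_at_unitZone_of_pub hBF hmod hLrat hGZK h2 hC h412 hcork hP108 hWL A hcm hr hss ha hz

end Summit.BirchSwinnertonDyer.BirchSwinnertonDyer.Theorems

end
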